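import Mathlib
import Literature.Probability.LatticeModels.ThermodynamicLimit
import Literature.Probability.LatticeModels.SharpnessProofs
import Summits.CriticalPhenomena.Ising3DConformalLimit.Theorems.PrecisionLaplacianDirectCorrelationStableTailKernelScalingAux2
import Summits.CriticalPhenomena.Ising3DConformalLimit.Theorems.PrecisionLaplacianDirectCorrelationStableTailKernelScalingAux5
import HarnessLib

/-!
# Helpers (VI) for stub `stub_kernelScaling` of line `diffusive-branch-is-nonsaturation`
(crux `PrecisionLaplacian.DirectCorrelationStableTail`, item stmt-CriticalPhenomena-4799)

**Kernel approximation and uniform lattice Riemann sums against the Riesz kernel** (registered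
helper sub-goal `stub_kernelScaling_auxRiemann`).  Let `G : ℤ³ → [0,1]` satisfy
`G(x)|x|₂^{3-α} → c > 0` cofinitely, `1 < α < 2`.

* `kernSc_kernelApprox`: the rescaled step kernel `g_R(v) = R^{3-α}G(⌊Rv⌋)` converges to
  `c|v|₂^{α-3}` in `L¹(e^{-b|v+s|₂²}dv)`, uniformly in the shift `s`: near the origin both kernels are
  `O(‖v‖^{α-3})` plus `R^{3-α}` on the single cell of `0` (volume `R⁻³`), and
  `∫_{‖v‖≤2δ}‖v‖^{α-3} = O(δ^α)`; away from it `G(x) = (c + O(η))|x|₂^{α-3}` once `δR` is large and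
  `| |⌊Rv⌋/R|₂^{α-3} − |v|₂^{α-3} | ≤ 4δ^{α-4}/R`.
* `stub_kernelScaling_auxRiemann`: for a test function `h` with `|h| ≤ A e^{-a|·|₂²}` and
  `|h(w') − h(w)| ≤ L/R` whenever `‖w' − w‖ ≤ 1/R`,
  `|R^{-α} Σₓ G(x) h(x/R + s) − c ∫ |v|₂^{α-3} h(v+s) dv| ≤ ε` for `R ≥ R₀(a, A, L, ε)`, uniformly in
  `s ∈ ℝ³` and in `h`: the lattice sum is `∫ g_R(v) h(⌊Rv⌋/R + s) dv`; subtracting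
  `c|v|₂^{α-3}h(v+s)` leaves `(g_R − c|v|₂^{α-3}) h(⌊Rv⌋/R+s)` (kernel approximation and the
  fattened envelope) plus `c|v|₂^{α-3}(h(⌊Rv⌋/R+s) − h(v+s))`, bounded by
  `c|v|₂^{α-3} min(L/R, 2A'e^{-(a/2)|v+s|₂²})` and handled by the min trick of file (V).

All statements are folklore; no definitions are introduced.
-/

noncomputable section

namespace Summit.CriticalPhenomena.Ising3DConformalLimit.Cruxes.DirectCorrelationStableTail.DiffusiveBranchIsNonsaturation

open MeasureTheory Filter Topology
open scoped BigOperators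
open Literature.Probability.LatticeModels
open Summit.CriticalPhenomena.Ising3DConformalLimit.Cruxes.DirectCorrelationStableTail.SelfEnergyPickInversion

/-! ### The kernel approximation -/

/-- **Kernel approximation at scale.**  The rescaled step
kernel `R^{3-α}G(⌊Rv⌋)` converges to `c|v|₂^{α-3}` in `L¹(e^{-b|v+s|₂²}dv)`, uniformly in the shift
`s`, under the isotropic pure power law `G(x)|x|₂^{3-α} → c`, `0 ≤ G ≤ 1`, `1 < α < 2`.
[folklore] -/
theorem kernSc_kernelApprox :
    ∀ (G : Site 3 → ℝ) (α c : ℝ), (∀ x, 0 ≤ G x) → (∀ x, G x ≤ 1) → 1 < α → α < 2 → 0 < c →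
      Filter.Tendsto (fun x : Site 3 => G x * Real.sqrt (∑ i, ((x i : ℝ)) ^ 2) ^ (3 - α))
        Filter.cofinite (nhds c) →
      ∀ b ε : ℝ, 0 < b → 0 < ε → ∃ R₀ : ℕ, 1 ≤ R₀ ∧ ∀ R : ℕ, R₀ ≤ R → ∀ s : Fin 3 → ℝ,
        MeasureTheory.Integrable (fun v : Fin 3 → ℝ =>
          |(R : ℝ) ^ (3 - α) * G (fun i => ⌊(R : ℝ) * v i⌋) -
              c * Real.sqrt (∑ i, v i ^ 2) ^ (α - 3)| *
            Real.exp (-(b * ∑ i, (v i + s i) ^ 2))) ∧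
        ∫ v : Fin 3 → ℝ, |(R : ℝ) ^ (3 - α) * G (fun i => ⌊(R : ℝ) * v i⌋) -
            c * Real.sqrt (∑ i, v i ^ 2) ^ (α - 3)| *
          Real.exp (-(b * ∑ i, (v i + s i) ^ 2)) ≤ ε := by
  intro G α c hG0 hG1 hα1 hα2 hc hT b ε hb hε
  have hα3 : α - 3 < 0 := by linarith
  -- constants
  obtain ⟨C₀, hC₀, hup⟩ := kernSc_kernel_upper (by linarith : α < 3) hc hG1 hT
  set B : ℝ := (volume : Measure (Fin 3 → ℝ)).real (Metric.ball 0 1) with hB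
  have hB0 : 0 ≤ B := measureReal_nonneg
  set J : ℝ := ∫ v : Fin 3 → ℝ, Real.exp (-(b * ∑ i, v i ^ 2)) with hJ
  have hJ0 : 0 ≤ J := integral_nonneg fun v => (Real.exp_pos _).le
  set M : ℝ := (9 * C₀ + c) * (3 * B / α) with hM
  have hM0 : 0 ≤ M := by positivity
  obtain ⟨δ, hδ0, hδ4, hδM⟩ := kernSc_exists_delta hM0 hε
  set η : ℝ := ε / 4 / (δ ^ (α - 3) * J + 1) with hη
  have hη0 : 0 < η := by positivity
  have hηJ : η * (δ ^ (α - 3) * J) ≤ ε / 4 := by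
    have h1 : η * (δ ^ (α - 3) * J + 1) = ε / 4 := by
      rw [hη]
      field_simp
    nlinarith [mul_nonneg hη0.le (le_refl (0 : ℝ))]
  obtain ⟨N, hN1, hN⟩ := kernSc_kernel_asymp hT hη0
  obtain ⟨R₀, hR₀⟩ := exists_nat_ge (max (max (2 / δ) (2 * N / δ))
    (max (4 / ε) (16 * c * δ ^ (α - 4) * J / ε)) + 1)
  have hR₀pos : (1 : ℝ) ≤ R₀ := by
    have h0 : 2 / δ ≤ max (max (2 / δ) (2 * N / δ)) (max (4 / ε) (16 * c * δ ^ (α - 4) * J / ε)) :=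
      (le_max_left _ _).trans (le_max_left _ _)
    linarith [(by positivity : (0 : ℝ) ≤ 2 / δ)]
  refine ⟨R₀, by exact_mod_cast hR₀pos, fun R hR s => ?_⟩
  -- consequences of `R ≥ R₀`
  have hRR₀ : (R₀ : ℝ) ≤ R := by exact_mod_cast hR
  have hR1 : (1 : ℝ) ≤ R := hR₀pos.trans hRR₀
  have hRpos : (0 : ℝ) < R := one_pos.trans_le hR1
  have hmax : max (max (2 / δ) (2 * N / δ)) (max (4 / ε) (16 * c * δ ^ (α - 4) * J / ε)) ≤ R :=
    by linarith
  have hRδ : 2 / R ≤ δ := by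
    have h : 2 / δ ≤ R := (le_max_left _ _).trans ((le_max_left _ _).trans hmax)
    rw [div_le_iff₀ hRpos]
    rw [div_le_iff₀ hδ0] at h
    linarith
  have hRN : (N : ℝ) ≤ R * δ / 2 := by
    have h : 2 * N / δ ≤ R := (le_max_right _ _).trans ((le_max_left _ _).trans hmax)
    rw [div_le_iff₀ hδ0] at h
    linarith
  have hRε : 1 / R ≤ ε / 4 := by
    have h : 4 / ε ≤ R := (le_max_left _ _).trans ((le_max_right _ _).trans hmax)
    rw [div_le_iff₀ hε] at h
    rw [div_le_iff₀ hRpos]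
    linarith
  have hR4 : 4 * c * δ ^ (α - 4) / R * J ≤ ε / 4 := by
    have h : 16 * c * δ ^ (α - 4) * J / ε ≤ R :=
      (le_max_right _ _).trans ((le_max_right _ _).trans hmax)
    rw [div_le_iff₀ hε] at h
    rw [div_mul_eq_mul_div, div_le_iff₀ hRpos]
    linarith
  -- notation
  set g : (Fin 3 → ℝ) → ℝ := fun v => (R : ℝ) ^ (3 - α) * G (fun i => ⌊(R : ℝ) * v i⌋) with hg
  set κ : (Fin 3 → ℝ) → ℝ := fun v => c * √(∑ i, v i ^ 2) ^ (α - 3) with hκ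
  set e : (Fin 3 → ℝ) → ℝ := fun v => Real.exp (-(b * ∑ i, (v i + s i) ^ 2)) with he
  set e₁ : (Fin 3 → ℝ) → ℝ := fun v =>
    ((fun v : Fin 3 → ℝ => (fun i => ⌊(R : ℝ) * v i⌋ : Site 3)) ⁻¹' {0}).indicator
      (fun _ => (R : ℝ) ^ (3 - α)) v with he₁
  set e₂ : (Fin 3 → ℝ) → ℝ := fun v =>
    (9 * C₀ + c) * (Metric.closedBall (0 : Fin 3 → ℝ) (2 * δ)).indicator
      (fun v => ‖v‖ ^ (α - 3)) v with he₂
  set e₃ : (Fin 3 → ℝ) → ℝ := fun v => η * δ ^ (α - 3) * e v with he₃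
  set e₄ : (Fin 3 → ℝ) → ℝ := fun v => 4 * c * δ ^ (α - 4) / R * e v with he₄
  have he0 : ∀ v, 0 ≤ e v := fun v => (Real.exp_pos _).le
  have he1 : ∀ v, e v ≤ 1 := fun v => by
    rw [he, Real.exp_le_one_iff, neg_nonpos]
    exact mul_nonneg hb.le (Finset.sum_nonneg fun i _ => sq_nonneg _)
  have he₁0 : ∀ v, 0 ≤ e₁ v := fun v =>
    Set.indicator_nonneg (fun _ _ => Real.rpow_nonneg hRpos.le _) v
  have hind0 : ∀ v, 0 ≤ (Metric.closedBall (0 : Fin 3 → ℝ) (2 * δ)).indicator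
      (fun v => ‖v‖ ^ (α - 3)) v := fun v =>
    Set.indicator_nonneg (fun w _ => Real.rpow_nonneg (norm_nonneg w) _) v
  have he₂0 : ∀ v, 0 ≤ e₂ v := fun v => mul_nonneg (by positivity) (hind0 v)
  have he₃0 : ∀ v, 0 ≤ e₃ v := fun v => by positivity
  have he₄0 : ∀ v, 0 ≤ e₄ v := fun v => by positivity
  -- the pointwise bound
  have hpt : ∀ v, |g v - κ v| * e v ≤ e₁ v + e₂ v + e₃ v + e₄ v := by
    intro v
    have hg0 : 0 ≤ g v := mul_nonneg (Real.rpow_nonneg hRpos.le _) (hG0 _)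
    have hκ0 : 0 ≤ κ v := mul_nonneg hc.le (Real.rpow_nonneg (Real.sqrt_nonneg _) _)
    by_cases hnear : √(∑ i, v i ^ 2) ≤ 2 * δ
    · -- near region
      have hκ : κ v ≤ c * ‖v‖ ^ (α - 3) :=
        mul_le_mul_of_nonneg_left (kernSc_euclid_rpow_le_norm_rpow hα3 v) hc.le
      have hvball : v ∈ Metric.closedBall (0 : Fin 3 → ℝ) (2 * δ) :=
        mem_closedBall_zero_iff.2 ((norm_le_sqrt_sum_sq v).trans hnear)
      have he₂v : e₂ v = (9 * C₀ + c) * ‖v‖ ^ (α - 3) := by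
        rw [he₂]
        simp only [Set.indicator_of_mem hvball]
      have hgb : g v ≤ e₁ v + 9 * C₀ * ‖v‖ ^ (α - 3) :=
        kernSc_stepKernel_le hG1 hα1 hα3 hC₀ hup hRpos v
      have habs : |g v - κ v| ≤ g v + κ v := by
        rw [abs_sub_le_iff]
        constructor <;> linarith
      calc |g v - κ v| * e v ≤ (g v + κ v) * 1 := mul_le_mul habs (he1 v) (he0 v) (by linarith)
        _ ≤ e₁ v + e₂ v := by rw [he₂v]; linarith
        _ ≤ e₁ v + e₂ v + e₃ v + e₄ v := by linarith [he₃0 v, he₄0 v]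
    · -- far region
      push Not at hnear
      have hfar := kernSc_stepKernel_far hα1 hα2 hc hδ0 hη0 hN hRpos hRδ hRN v hnear
      calc |g v - κ v| * e v ≤ (η * δ ^ (α - 3) + 4 * c * δ ^ (α - 4) / R) * e v :=
            mul_le_mul_of_nonneg_right hfar (he0 v)
        _ = e₃ v + e₄ v := by
            rw [he₃, he₄]
            ring
        _ ≤ e₁ v + e₂ v + e₃ v + e₄ v := by linarith [he₁0 v, he₂0 v]
  -- integrability and integrals of the four densities
  have hfl := kernSc_measurable_floorMap (R : ℝ)
  have hcell : MeasurableSet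
      ((fun v : Fin 3 → ℝ => (fun i => ⌊(R : ℝ) * v i⌋ : Site 3)) ⁻¹' {0}) :=
    hfl (measurableSet_singleton 0)
  have hcellvol := kernSc_volume_floorMap_fiber hRpos (0 : Site 3)
  have hi₁ : Integrable e₁ := by
    rw [he₁, integrable_indicator_iff hcell]
    exact integrableOn_const (by rw [hcellvol]; exact ENNReal.ofReal_ne_top)
  have hI₁ : ∫ v, e₁ v = (R : ℝ) ^ (3 - α) * ((R : ℝ) ^ 3)⁻¹ := by
    rw [he₁, integral_indicator_const _ hcell, measureReal_def, hcellvol,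
      ENNReal.toReal_ofReal (by positivity), smul_eq_mul, mul_comm]
  have hball := kernSc_integral_norm_rpow_ball (β := α - 3) (by linarith)
    (by positivity : 0 < 2 * δ)
  have hi₂ : Integrable e₂ := hball.1.const_mul _
  have hI₂ : ∫ v, e₂ v = M * (2 * δ) ^ α := by
    rw [he₂, integral_const_mul, hball.2, show α - 3 + 3 = α by ring, hM]
    ring
  have hgauss : Integrable e := kernSc_integrable_gauss hb s
  have hIe : ∫ v, e v = J := by
    have h := integral_add_right_eq_self (μ := (volume : Measure (Fin 3 → ℝ)))
      (fun v : Fin 3 → ℝ => Real.exp (-(b * ∑ i, v i ^ 2))) s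
    simpa only [Pi.add_apply] using h
  have hi₃ : Integrable e₃ := hgauss.const_mul _
  have hI₃ : ∫ v, e₃ v = η * δ ^ (α - 3) * J := by rw [he₃, integral_const_mul, hIe]
  have hi₄ : Integrable e₄ := hgauss.const_mul _
  have hI₄ : ∫ v, e₄ v = 4 * c * δ ^ (α - 4) / R * J := by rw [he₄, integral_const_mul, hIe]
  have hi12 : Integrable (fun v => e₁ v + e₂ v) := hi₁.add hi₂
  have hi123 : Integrable (fun v => e₁ v + e₂ v + e₃ v) := hi12.add hi₃
  have hsum : Integrable (fun v => e₁ v + e₂ v + e₃ v + e₄ v) := hi123.add hi₄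
  -- integrability of the target
  have hmeas : AEStronglyMeasurable (fun v => |g v - κ v| * e v) := by
    have hgm : Measurable g := ((measurable_of_countable G).comp hfl).const_mul _
    have hκm : Measurable κ := (kernSc_measurable_euclid_rpow (α - 3)).const_mul c
    have hem : Measurable e := by
      rw [he]
      fun_prop
    exact ((continuous_abs.measurable.comp (hgm.sub hκm)).mul hem).aestronglyMeasurable
  have hint : Integrable (fun v => |g v - κ v| * e v) :=
    Integrable.mono' hsum hmeas (ae_of_all _ fun v => by
      rw [Real.norm_eq_abs, abs_of_nonneg (mul_nonneg (abs_nonneg _) (he0 v))]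
      exact hpt v)
  refine ⟨hint, ?_⟩
  -- the four integrals are `≤ ε/4`
  have hb₁ : (R : ℝ) ^ (3 - α) * ((R : ℝ) ^ 3)⁻¹ ≤ ε / 4 :=
    (kernSc_rpow_three_sub_mul_inv_cube hR1 hα1.le).trans hRε
  have hb₂ : M * (2 * δ) ^ α ≤ ε / 4 := by
    have h1 : (2 * δ) ^ α ≤ (2 * δ) ^ (1 : ℝ) :=
      Real.rpow_le_rpow_of_exponent_ge (by positivity) (by linarith) hα1.le
    rw [Real.rpow_one] at h1
    exact (mul_le_mul_of_nonneg_left h1 hM0).trans hδM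
  calc ∫ v, |g v - κ v| * e v ≤ ∫ v, (e₁ v + e₂ v + e₃ v + e₄ v) := integral_mono hint hsum hpt
    _ = (∫ v, e₁ v) + (∫ v, e₂ v) + (∫ v, e₃ v) + ∫ v, e₄ v := by
        rw [integral_add hi123 hi₄, integral_add hi12 hi₃, integral_add hi₁ hi₂]
    _ ≤ ε / 4 + ε / 4 + ε / 4 + ε / 4 := by
        rw [hI₁, hI₂, hI₃, hI₄]
        have hb₃ : η * δ ^ (α - 3) * J ≤ ε / 4 := by
          rw [mul_assoc]
          exact hηJ
        exact add_le_add (add_le_add (add_le_add hb₁ hb₂) hb₃) hR4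
    _ = ε := by ring

/-! ### The uniform Riemann lemma -/

/-- Pointwise comparison of the two integrands of the Riemann lemma: with `w = ⌊Rv⌋/R`,
`|g h(w+s) − κ h(v+s)| ≤ A' |g − κ| e^{-(a/2)|v+s|₂²} + c|v|₂^{α-3} min(γ, 2A'e^{-(a/2)|v+s|₂²})`,
where `g = R^{3-α}G(⌊Rv⌋)`, `κ = c|v|₂^{α-3}`, given the envelope, the Lipschitz bound at scale `1/R`
and `L/R ≤ γ`. [folklore] -/
theorem kernSc_riemann_pt {G : Site 3 → ℝ} {α c a A A' L γ R : ℝ} (hc : 0 ≤ c) (ha : 0 ≤ a)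
    (hA : 0 ≤ A) (hR : 1 ≤ R) (hA' : A * Real.exp (3 * a) ≤ A') {h : (Fin 3 → ℝ) → ℝ}
    (henv : ∀ w, |h w| ≤ A * Real.exp (-(a * ∑ i, w i ^ 2)))
    (hlip : ∀ w w' : Fin 3 → ℝ, ‖w' - w‖ ≤ 1 / R → |h w' - h w| ≤ L / R) (hLγ : L / R ≤ γ)
    (s v : Fin 3 → ℝ) :
    |R ^ (3 - α) * (G (fun i => ⌊R * v i⌋) * h (fun i => ((⌊R * v i⌋ : ℤ) : ℝ) / R + s i)) -
        c * (√(∑ i, v i ^ 2) ^ (α - 3) * h (v + s))| ≤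
      A' * (|R ^ (3 - α) * G (fun i => ⌊R * v i⌋) - c * √(∑ i, v i ^ 2) ^ (α - 3)| *
          Real.exp (-(a / 2 * ∑ i, (v i + s i) ^ 2))) +
        c * (√(∑ i, v i ^ 2) ^ (α - 3) *
          min γ (2 * A' * Real.exp (-(a / 2 * ∑ i, (v i + s i) ^ 2)))) := by
  have hRpos : 0 < R := one_pos.trans_le hR
  set g : ℝ := R ^ (3 - α) * G (fun i => ⌊R * v i⌋) with hg
  set κ : ℝ := c * √(∑ i, v i ^ 2) ^ (α - 3) with hκ
  set H₁ : ℝ := h (fun i => ((⌊R * v i⌋ : ℤ) : ℝ) / R + s i) with hH₁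
  set H₂ : ℝ := h (v + s) with hH₂
  set e₂ : ℝ := Real.exp (-(a / 2 * ∑ i, (v i + s i) ^ 2)) with he₂
  have hκ0 : 0 ≤ κ := mul_nonneg hc (Real.rpow_nonneg (Real.sqrt_nonneg _) _)
  have hA'0 : 0 ≤ A' := le_trans (by positivity) hA'
  -- the envelope of `H₁` and `H₂`
  have hH₁le : |H₁| ≤ A' * e₂ := by
    calc |H₁| ≤ A * Real.exp (-(a * ∑ i, (((⌊R * v i⌋ : ℤ) : ℝ) / R + s i) ^ 2)) := henv _
      _ ≤ A * (Real.exp (3 * a) * e₂) := mul_le_mul_of_nonneg_left (kernSc_exp_floor_le ha hR v s) hA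
      _ = A * Real.exp (3 * a) * e₂ := by ring
      _ ≤ A' * e₂ := mul_le_mul_of_nonneg_right hA' (Real.exp_pos _).le
  have hH₂le : |H₂| ≤ A' * e₂ := by
    have h1 : |H₂| ≤ A * Real.exp (-(a * ∑ i, (v i + s i) ^ 2)) := by
      simpa only [Pi.add_apply] using henv (v + s)
    have h2 : Real.exp (-(a * ∑ i, (v i + s i) ^ 2)) ≤ e₂ := by
      have hq : 0 ≤ ∑ i, (v i + s i) ^ 2 := Finset.sum_nonneg fun i _ => sq_nonneg (v i + s i)
      exact Real.exp_le_exp.2 (by nlinarith [mul_nonneg ha hq])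
    have h3 : A ≤ A' := (le_mul_of_one_le_right hA (Real.one_le_exp (by positivity))).trans hA'
    calc |H₂| ≤ A * Real.exp (-(a * ∑ i, (v i + s i) ^ 2)) := h1
      _ ≤ A' * e₂ := mul_le_mul h3 h2 (Real.exp_pos _).le hA'0
  -- the Lipschitz bound
  have hH₁₂ : |H₁ - H₂| ≤ min γ (2 * A' * e₂) := by
    refine le_min ?_ ?_
    · have hnorm : ‖(fun i => ((⌊R * v i⌋ : ℤ) : ℝ) / R + s i) - (v + s)‖ ≤ 1 / R := by
        have h1 : (fun i => ((⌊R * v i⌋ : ℤ) : ℝ) / R + s i) - (v + s) =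
            (fun i => ((⌊R * v i⌋ : ℤ) : ℝ) / R) - v := by
          funext i
          simp only [Pi.sub_apply, Pi.add_apply]
          ring
        rw [h1, norm_sub_rev]
        exact kernSc_norm_sub_floor_le hRpos v
      exact (hlip _ _ hnorm).trans hLγ
    · calc |H₁ - H₂| ≤ |H₁| + |H₂| := abs_sub _ _
        _ ≤ A' * e₂ + A' * e₂ := add_le_add hH₁le hH₂le
        _ = 2 * A' * e₂ := by ring
  -- conclusion
  have hsplit : R ^ (3 - α) * (G (fun i => ⌊R * v i⌋) * H₁) - c * (√(∑ i, v i ^ 2) ^ (α - 3) * H₂) =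
      (g - κ) * H₁ + κ * (H₁ - H₂) := by
    rw [hg, hκ]
    ring
  rw [hsplit]
  calc |(g - κ) * H₁ + κ * (H₁ - H₂)| ≤ |(g - κ) * H₁| + |κ * (H₁ - H₂)| := abs_add_le _ _
    _ = |g - κ| * |H₁| + κ * |H₁ - H₂| := by rw [abs_mul, abs_mul, abs_of_nonneg hκ0]
    _ ≤ |g - κ| * (A' * e₂) + κ * min γ (2 * A' * e₂) :=
        add_le_add (mul_le_mul_of_nonneg_left hH₁le (abs_nonneg _))
          (mul_le_mul_of_nonneg_left hH₁₂ hκ0)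
    _ = A' * (|g - κ| * e₂) + c * (√(∑ i, v i ^ 2) ^ (α - 3) * min γ (2 * A' * e₂)) := by
        rw [hκ]
        ring

/-- **Registered helper sub-goal `stub_kernelScaling_auxRiemann`** of stub `stub_kernelScaling`
(line `diffusive-branch-is-nonsaturation`, crux stmt-CriticalPhenomena-4799): uniform lattice Riemann
sums against the Riesz kernel.  Under `G(x)|x|₂^{3-α} → c` (`0 ≤ G ≤ 1`, `1 < α < 2`), for every
continuous `h` with `|h| ≤ A e^{-a|·|₂²}` and `|h(w') − h(w)| ≤ L/R` whenever `‖w' − w‖ ≤ 1/R`,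
`|R^{-α} Σₓ G(x) h(x/R + s) − c ∫ |v|₂^{α-3} h(v+s) dv| ≤ ε` for `R ≥ R₀(a, A, L, ε)`, uniformly in
`s ∈ ℝ³` and in `h`. [folklore] -/
theorem stub_kernelScaling_auxRiemann :
    ∀ (G : Site 3 → ℝ) (α c : ℝ), (∀ x, 0 ≤ G x) → (∀ x, G x ≤ 1) → 1 < α → α < 2 → 0 < c →
      Filter.Tendsto (fun x : Site 3 => G x * Real.sqrt (∑ i, ((x i : ℝ)) ^ 2) ^ (3 - α))
        Filter.cofinite (nhds c) →
      ∀ a A L ε : ℝ, 0 < a → 0 ≤ A → 0 ≤ L → 0 < ε → ∃ R₀ : ℕ, 1 ≤ R₀ ∧ ∀ R : ℕ, R₀ ≤ R →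
        ∀ (h : (Fin 3 → ℝ) → ℝ), Continuous h →
          (∀ w, |h w| ≤ A * Real.exp (-(a * ∑ i, w i ^ 2))) →
          (∀ w w' : Fin 3 → ℝ, ‖w' - w‖ ≤ 1 / (R : ℝ) → |h w' - h w| ≤ L / (R : ℝ)) →
          ∀ s : Fin 3 → ℝ,
            Summable (fun x : Site 3 => G x * h (fun i => (x i : ℝ) / R + s i)) ∧
            MeasureTheory.Integrable
              (fun v : Fin 3 → ℝ => Real.sqrt (∑ i, v i ^ 2) ^ (α - 3) * h (v + s)) ∧
            |(R : ℝ) ^ (-α) * ∑' x : Site 3, G x * h (fun i => (x i : ℝ) / R + s i) -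
                c * ∫ v : Fin 3 → ℝ, Real.sqrt (∑ i, v i ^ 2) ^ (α - 3) * h (v + s)| ≤ ε := by
  intro G α c hG0 hG1 hα1 hα2 hc hT a A L ε ha hA hL hε
  set A' : ℝ := A * Real.exp (3 * a) with hA'
  have hA'0 : 0 ≤ A' := by positivity
  obtain ⟨R₁, hR₁, hK⟩ := kernSc_kernelApprox G α c hG0 hG1 hα1 hα2 hc hT (a / 2)
    (ε / 2 / (A' + 1)) (half_pos ha) (by positivity)
  obtain ⟨γ, hγ0, hM⟩ := kernSc_minTrick hα1 hα2 (b := a / 2) (C := 2 * A') (ε := ε / 2 / c)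
    (half_pos ha) (by positivity) (by positivity)
  obtain ⟨R₀, hR₀⟩ := exists_nat_ge (max (R₁ : ℝ) (L / γ) + 1)
  have hR₀1 : (1 : ℝ) ≤ R₀ := by
    have : (0 : ℝ) ≤ max (R₁ : ℝ) (L / γ) := le_max_of_le_left (Nat.cast_nonneg _)
    linarith
  refine ⟨R₀, by exact_mod_cast hR₀1, fun R hR h hcont henv hlip s => ?_⟩
  have hRR₀ : (R₀ : ℝ) ≤ R := by exact_mod_cast hR
  have hR1 : (1 : ℝ) ≤ R := hR₀1.trans hRR₀
  have hRnat : 1 ≤ R := by exact_mod_cast hR1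
  have hRpos : (0 : ℝ) < R := one_pos.trans_le hR1
  have hRR₁ : R₁ ≤ R := by
    have h1 : (R₁ : ℝ) ≤ R := by linarith [le_max_left (R₁ : ℝ) (L / γ)]
    exact_mod_cast h1
  have hLγ : L / R ≤ γ := by
    have h1 : L / γ ≤ R := by linarith [le_max_right (R₁ : ℝ) (L / γ)]
    rw [div_le_iff₀ hRpos]
    rw [div_le_iff₀ hγ0] at h1
    linarith
  obtain ⟨hsum, hintF, hSval⟩ := kernSc_sum_as_integral hG0 hG1 α ha hA hRnat hcont henv s
  have henv' : ∀ v : Fin 3 → ℝ, |h (v + s)| ≤ A * Real.exp (-(a * ∑ i, (v i + s i) ^ 2)) :=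
    fun v => by simpa only [Pi.add_apply] using henv (v + s)
  have hintI : Integrable (fun v : Fin 3 → ℝ => √(∑ i, v i ^ 2) ^ (α - 3) * h (v + s)) :=
    kernSc_integrable_kernel_mul (by linarith) (by linarith)
      (hcont.comp (continuous_id.add continuous_const)).aestronglyMeasurable ha hA s henv'
  refine ⟨hsum, hintI, ?_⟩
  have hKR := hK R hRR₁ s
  have hMs := hM s
  set bound : (Fin 3 → ℝ) → ℝ := fun v =>
    A' * (|(R : ℝ) ^ (3 - α) * G (fun i => ⌊(R : ℝ) * v i⌋) - c * √(∑ i, v i ^ 2) ^ (α - 3)| *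
        Real.exp (-(a / 2 * ∑ i, (v i + s i) ^ 2))) +
      c * (√(∑ i, v i ^ 2) ^ (α - 3) *
        min γ (2 * A' * Real.exp (-(a / 2 * ∑ i, (v i + s i) ^ 2)))) with hbound
  have hi1 : Integrable (fun v : Fin 3 → ℝ =>
      A' * (|(R : ℝ) ^ (3 - α) * G (fun i => ⌊(R : ℝ) * v i⌋) - c * √(∑ i, v i ^ 2) ^ (α - 3)| *
        Real.exp (-(a / 2 * ∑ i, (v i + s i) ^ 2)))) := hKR.1.const_mul A'
  have hi2 : Integrable (fun v : Fin 3 → ℝ => c * (√(∑ i, v i ^ 2) ^ (α - 3) *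
      min γ (2 * A' * Real.exp (-(a / 2 * ∑ i, (v i + s i) ^ 2))))) := hMs.1.const_mul c
  have hbint : Integrable bound := hi1.add hi2
  have hpt : ∀ v : Fin 3 → ℝ,
      ‖(R : ℝ) ^ (3 - α) * (G (fun i => ⌊(R : ℝ) * v i⌋) *
          h (fun i => ((⌊(R : ℝ) * v i⌋ : ℤ) : ℝ) / R + s i)) -
        c * (√(∑ i, v i ^ 2) ^ (α - 3) * h (v + s))‖ ≤ bound v := fun v => by
    rw [Real.norm_eq_abs]
    exact kernSc_riemann_pt hc.le ha.le hA hR1 le_rfl henv hlip hLγ s v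
  have hdiff : (R : ℝ) ^ (-α) * ∑' x : Site 3, G x * h (fun i => (x i : ℝ) / R + s i) -
      c * ∫ v : Fin 3 → ℝ, √(∑ i, v i ^ 2) ^ (α - 3) * h (v + s) =
      ∫ v : Fin 3 → ℝ, ((R : ℝ) ^ (3 - α) * (G (fun i => ⌊(R : ℝ) * v i⌋) *
          h (fun i => ((⌊(R : ℝ) * v i⌋ : ℤ) : ℝ) / R + s i)) -
        c * (√(∑ i, v i ^ 2) ^ (α - 3) * h (v + s))) := by
    rw [hSval, ← integral_const_mul]
    exact (integral_sub hintF (hintI.const_mul c)).symm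
  rw [hdiff]
  have hb₁ : A' * (ε / 2 / (A' + 1)) ≤ ε / 2 := by
    rw [show A' * (ε / 2 / (A' + 1)) = ε / 2 * (A' / (A' + 1)) by field_simp]
    exact mul_le_of_le_one_right (by positivity) ((div_le_one (by positivity)).2 (by linarith))
  have hb₂ : c * (ε / 2 / c) = ε / 2 := by
    field_simp
  calc |∫ v : Fin 3 → ℝ, ((R : ℝ) ^ (3 - α) * (G (fun i => ⌊(R : ℝ) * v i⌋) *
          h (fun i => ((⌊(R : ℝ) * v i⌋ : ℤ) : ℝ) / R + s i)) -
        c * (√(∑ i, v i ^ 2) ^ (α - 3) * h (v + s)))|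
      ≤ ∫ v, bound v := by
        have h1 := norm_integral_le_of_norm_le hbint (ae_of_all _ hpt)
        rwa [Real.norm_eq_abs] at h1
    _ = A' * (∫ v : Fin 3 → ℝ, |(R : ℝ) ^ (3 - α) * G (fun i => ⌊(R : ℝ) * v i⌋) -
            c * √(∑ i, v i ^ 2) ^ (α - 3)| * Real.exp (-(a / 2 * ∑ i, (v i + s i) ^ 2))) +
        c * (∫ v : Fin 3 → ℝ, √(∑ i, v i ^ 2) ^ (α - 3) *
            min γ (2 * A' * Real.exp (-(a / 2 * ∑ i, (v i + s i) ^ 2)))) := by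
        rw [hbound, integral_add hi1 hi2, integral_const_mul, integral_const_mul]
    _ ≤ A' * (ε / 2 / (A' + 1)) + c * (ε / 2 / c) :=
        add_le_add (mul_le_mul_of_nonneg_left hKR.2 hA'0) (mul_le_mul_of_nonneg_left hMs.2 hc.le)
    _ ≤ ε / 2 + ε / 2 := add_le_add hb₁ hb₂.le
    _ = ε := by ring

end Summit.CriticalPhenomena.Ising3DConformalLimit.Cruxes.DirectCorrelationStableTail.DiffusiveBranchIsNonsaturation

end
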